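import Literature.Probability.RandomPlanarGeometry.SAWPulledBridgeFreeEnergyZdLowerEnvelope
import Literature.Probability.RandomPlanarGeometry.SAWPulledFreeEnergyConvex
import Literature.Probability.RandomPlanarGeometry.SAWPulledLargeForce
import Mathlib.Analysis.Convex.Deriv
import HarnessLib

/-!
# The extension densities of pulled bridges on `ℤ^{d+1}`, explicitly and uniformly in the dimension:
# `d(y − 2d)/((y + 4d)·log 2) ≤ y·(1 − 𝓔⁺_d(y)) ≤ y·(1 − 𝓔⁻_d(y)) ≤ 2d/log 2` for every `y ≥ 2`, every `d`

Topic `Literature/Probability/RandomPlanarGeometry` (every-dimension companion of `SAWPulledLargeForce.lean` — the PLANAR large-force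
law `y(1 − 𝓔^λ_±(y)) → 2` on `ℤ²` through chords of length `log(1 + y^{−1/2})` and the planar third-order window — built instead on the
DIMENSION-UNIFORM first-order envelopes of `SAWPulledBridgeFreeEnergyZdEnvelope.lean` / `…ZdLowerEnvelope.lean`
(`y + 2d − 4d²/(y+2d) ≤ e^{λ_B(y)} ≤ y + 2d`, every `y ≥ 1`, every `d`) and the convexity of `θ ↦ λ_B(e^θ)`
(`SAWPulledFreeEnergyConvex.pulledBridgeFreeEnergy_exp_convexOn`, every `d`)).

`𝓔⁺_d(y)`, `𝓔⁻_d(y)` are the one-sided derivatives of `θ ↦ λ_B^{ℤ^{d+1}}(e^θ)` at `θ = log y` — the asymptotic extension (force-axis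
span) per step of the pulled bridge (Janse van Rensburg–Whittington's `𝓔^λ_±`); `1 − 𝓔` is the density of steps NOT spent climbing.
Chords of ratio `2` (`y ↦ 2y`, `y ↦ y/2`) against the envelopes give, with no limit taken and constants free of `d`:

* `lamTildeZd d`, `rightExtensionZd d`, `leftExtensionZd d` — the every-dimension versions of the planar `lamTilde`, `rightExtension`,
  `leftExtension` (`lamTildeZd_one`, `rightExtensionZd_one`, `leftExtensionZd_one`: at `d = 1` they ARE the planar objects, by `rfl`);
* `rightExtensionZd_le_chord_two`, `chord_half_le_leftExtensionZd` — the two ratio-`2` chords (convexity);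
* ★ **`extensionZd_window (hy : 2 ≤ y) : d(y − 2d)/((y + 4d) log 2) ≤ y(1 − 𝓔⁺_d(y)) ≤ y(1 − 𝓔⁻_d(y)) ≤ 2d/log 2`** — in every dimension
  the pulled bridge at force `log y` is stretched except for a fraction between `≈ 1.44·d/y` and `≈ 2.89·d/y` of its steps
  (the planar LIMIT value is `2/y`; the every-`d` limit `2d` needs second-order chords — `TODO(sharp constant)`);
* `leftExtensionZd_pos` — ballistic: `𝓔⁻_d(y) > 0` as soon as `y > 2d/log 2` (`y ≥ 2`).

Printed status: Janse van Rensburg–Whittington (2013/2016) define `𝓔^λ_±` and prove `λ(y) ∼ log y`; explicit every-dimension windows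
for the extension density are, to our knowledge, not in print.  Provenance: lane «pcv-sawmu», a-p3 g26 (2026-08-28).  PURE STD, no data.
-/

noncomputable section

open Finset Filter Topology
open scoped BigOperators
open Literature.Probability.LatticeModels
open Literature.Probability.RandomPlanarGeometry.SAW

namespace Literature.Probability.RandomPlanarGeometry.SAW.Zd

/-! ### The objects, every dimension -/

/-- `λ̃_d(θ) := λ_B^{ℤ^{d+1}}(e^θ)` (the pulled-bridge free energy as a function of the force `θ = log y`).
[cite: JansevanRensburgWhittington2013, §3.2 (arXiv v4 p. 10)] -/
def lamTildeZd (d : ℕ) (θ : ℝ) : ℝ := pulledBridgeFreeEnergy (d + 1) (Real.exp θ)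

/-- **`𝓔⁺_d(y) := d⁺λ̃_d/dθ` at `θ = log y`** (right extension density on `ℤ^{d+1}`).
[cite: JansevanRensburgWhittington2013, §3.2 (arXiv v4 p. 10: 𝓔^λ_±(y) = y d^±λ/dy)] -/
def rightExtensionZd (d : ℕ) (y : ℝ) : ℝ := derivWithin (lamTildeZd d) (Set.Ioi (Real.log y)) (Real.log y)

/-- **`𝓔⁻_d(y) := d⁻λ̃_d/dθ` at `θ = log y`** (left extension density on `ℤ^{d+1}`).
[cite: JansevanRensburgWhittington2013, §3.2 (arXiv v4 p. 10)] -/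
def leftExtensionZd (d : ℕ) (y : ℝ) : ℝ := derivWithin (lamTildeZd d) (Set.Iio (Real.log y)) (Real.log y)

/-- At `d = 1` (the square lattice) `λ̃_1` is the planar `lamTilde` of `SAWPulledLargeForce.lean`. [cite: JansevanRensburgWhittington2013, §3.2] -/
theorem lamTildeZd_one : lamTildeZd 1 = lamTilde := rfl

/-- At `d = 1`, `𝓔⁺_1 = rightExtension` (planar). [cite: JansevanRensburgWhittington2013, §3.2] -/
theorem rightExtensionZd_one : rightExtensionZd 1 = rightExtension := rfl

/-- At `d = 1`, `𝓔⁻_1 = leftExtension` (planar). [cite: JansevanRensburgWhittington2013, §3.2] -/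
theorem leftExtensionZd_one : leftExtensionZd 1 = leftExtension := rfl

/-- `λ̃_d` is convex (every `d`). [cite: Beaton2015, §3] -/
theorem convexOn_lamTildeZd (d : ℕ) : ConvexOn ℝ Set.univ (lamTildeZd d) := pulledBridgeFreeEnergy_exp_convexOn d

/-- `λ̃_d(log y) = λ_B(y)` for `y > 0`. [cite: JansevanRensburgWhittington2013, §3.2] -/
theorem lamTildeZd_log (d : ℕ) {y : ℝ} (hy : 0 < y) : lamTildeZd d (Real.log y) = pulledBridgeFreeEnergy (d + 1) y := by
  rw [lamTildeZd, Real.exp_log hy]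

/-- `𝓔⁻_d ≤ 𝓔⁺_d` (convexity). [cite: JansevanRensburgWhittington2013, §3.2 (arXiv v4 p. 10)] -/
theorem leftExtensionZd_le_rightExtensionZd (d : ℕ) (y : ℝ) : leftExtensionZd d y ≤ rightExtensionZd d y :=
  (convexOn_lamTildeZd d).leftDeriv_le_rightDeriv_of_mem_interior (by simp)

/-- `𝓔⁺_d(y) ≤` every right chord of `λ̃_d` from `log y`. [cite: JansevanRensburgWhittington2013, §3.2 (arXiv v4 p. 10)] -/
theorem rightExtensionZd_le_slope (d : ℕ) {y θ' : ℝ} (h : Real.log y < θ') :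
    rightExtensionZd d y ≤ slope (lamTildeZd d) (Real.log y) θ' :=
  (convexOn_lamTildeZd d).rightDeriv_le_slope_of_mem_interior (by simp) (Set.mem_univ θ') h

/-- Every left chord of `λ̃_d` into `log y` is `≤ 𝓔⁻_d(y)`. [cite: JansevanRensburgWhittington2013, §3.2 (arXiv v4 p. 10)] -/
theorem slope_le_leftExtensionZd (d : ℕ) {y θ' : ℝ} (h : θ' < Real.log y) :
    slope (lamTildeZd d) θ' (Real.log y) ≤ leftExtensionZd d y :=
  (convexOn_lamTildeZd d).slope_le_leftDeriv_of_mem_interior (Set.mem_univ θ') (by simp) h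

/-! ### The two ratio-`2` chords -/

/-- Right chord of ratio `2`: `𝓔⁺_d(y) ≤ (λ_B(2y) − λ_B(y))/log 2` (`y > 0`). [cite: JansevanRensburgWhittington2013, §3.2] -/
theorem rightExtensionZd_le_chord_two (d : ℕ) {y : ℝ} (hy : 0 < y) :
    rightExtensionZd d y ≤ (pulledBridgeFreeEnergy (d + 1) (2 * y) - pulledBridgeFreeEnergy (d + 1) y) / Real.log 2 := by
  have hlog2 : 0 < Real.log 2 := Real.log_pos (by norm_num)
  have hθ : Real.log (2 * y) = Real.log y + Real.log 2 := by rw [Real.log_mul (by norm_num) hy.ne', add_comm]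
  have h := rightExtensionZd_le_slope d (show Real.log y < Real.log (2 * y) by rw [hθ]; linarith)
  rw [slope_def_field, lamTildeZd_log d hy, lamTildeZd_log d (by positivity), hθ, add_sub_cancel_left] at h
  exact h

/-- Left chord of ratio `2`: `(λ_B(y) − λ_B(y/2))/log 2 ≤ 𝓔⁻_d(y)` (`y > 0`). [cite: JansevanRensburgWhittington2013, §3.2] -/
theorem chord_half_le_leftExtensionZd (d : ℕ) {y : ℝ} (hy : 0 < y) :
    (pulledBridgeFreeEnergy (d + 1) y - pulledBridgeFreeEnergy (d + 1) (y / 2)) / Real.log 2 ≤ leftExtensionZd d y := by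
  have hlog2 : 0 < Real.log 2 := Real.log_pos (by norm_num)
  have hθ : Real.log (y / 2) = Real.log y - Real.log 2 := by rw [Real.log_div hy.ne' (by norm_num)]
  have h := slope_le_leftExtensionZd d (show Real.log (y / 2) < Real.log y by rw [hθ]; linarith)
  rw [slope_def_field, lamTildeZd_log d hy, lamTildeZd_log d (by positivity), hθ, sub_sub_cancel] at h
  exact h

/-! ### The envelopes in logarithmic form -/

/-- `log((y² + 4dy)/(y + 2d)) ≤ λ_B(y)` for `y ≥ 1` (the lower envelope `y + 2d − 4d²/(y+2d) ≤ e^{λ_B(y)}`).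
[cite: Beaton2015, §3, Lemma 1, eq. (7)] -/
theorem log_lower_envelope_le_pulledBridgeFreeEnergy (d : ℕ) {y : ℝ} (hy : 1 ≤ y) :
    Real.log ((y ^ 2 + 4 * d * y) / (y + 2 * d)) ≤ pulledBridgeFreeEnergy (d + 1) y := by
  have hy0 : 0 < y := by linarith
  have hd : (0 : ℝ) ≤ d := by positivity
  have h := two_mul_sub_le_exp_pulledBridgeFreeEnergy_sub d hy
  have hpos : 0 < (y ^ 2 + 4 * d * y) / (y + 2 * d) := by positivity
  have heq : (y ^ 2 + 4 * d * y) / (y + 2 * d) = y + (2 * d - 4 * d ^ 2 / (y + 2 * d)) := by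
    field_simp
    ring
  have hle : (y ^ 2 + 4 * d * y) / (y + 2 * d) ≤ Real.exp (pulledBridgeFreeEnergy (d + 1) y) := by rw [heq]; linarith
  have := Real.log_le_log hpos hle
  rwa [Real.log_exp] at this

/-! ### The window -/

/-- **Lower side**: `d(y − 2d)/((y + 4d)·log 2) ≤ y·(1 − 𝓔⁺_d(y))` for every `y ≥ 1` and every `d` (right chord of ratio `2`:
`1 − 𝓔⁺ ≥ log((y²+4dy)/((y+d)(y+2d)))/log 2 ≥ d(y−2d)/(y(y+4d) log 2)`). [cite: JansevanRensburgWhittington2013, §3.2 Corollary 2 (arXiv v4 p. 11)] -/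
theorem div_le_mul_one_sub_rightExtensionZd (d : ℕ) {y : ℝ} (hy : 1 ≤ y) :
    d * (y - 2 * d) / ((y + 4 * d) * Real.log 2) ≤ y * (1 - rightExtensionZd d y) := by
  have hy0 : 0 < y := by linarith
  have hd : (0 : ℝ) ≤ d := by positivity
  have hlog2 : 0 < Real.log 2 := Real.log_pos (by norm_num)
  have hchord := rightExtensionZd_le_chord_two d hy0
  have hup : pulledBridgeFreeEnergy (d + 1) (2 * y) ≤ Real.log (2 * y + 2 * d) :=
    pulledBridgeFreeEnergy_le_log_add d (by linarith)
  have hlow := log_lower_envelope_le_pulledBridgeFreeEnergy d hy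
  -- the ratio `x = (y²+4dy)/((y+d)(y+2d))` and `1 − 1/x = d(y−2d)/(y²+4dy)`
  have hx0 : 0 < (y ^ 2 + 4 * d * y) / ((y + d) * (y + 2 * d)) := by positivity
  have hlogx : Real.log ((y ^ 2 + 4 * d * y) / ((y + d) * (y + 2 * d)))
      = Real.log 2 + Real.log ((y ^ 2 + 4 * d * y) / (y + 2 * d)) - Real.log (2 * y + 2 * d) := by
    have e : (y ^ 2 + 4 * d * y) / ((y + d) * (y + 2 * d)) = 2 * ((y ^ 2 + 4 * d * y) / (y + 2 * d)) / (2 * y + 2 * d) := by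
      field_simp
    rw [e, Real.log_div (show (2 * ((y ^ 2 + 4 * d * y) / (y + 2 * d)) : ℝ) ≠ 0 by positivity)
      (show (2 * y + 2 * d : ℝ) ≠ 0 by positivity),
      Real.log_mul (show (2 : ℝ) ≠ 0 by norm_num) (show ((y ^ 2 + 4 * d * y) / (y + 2 * d) : ℝ) ≠ 0 by positivity)]
  have hkey : d * (y - 2 * d) / (y ^ 2 + 4 * d * y) ≤ Real.log ((y ^ 2 + 4 * d * y) / ((y + d) * (y + 2 * d))) := by
    have h := Real.one_sub_inv_le_log_of_pos hx0
    have e : 1 - ((y ^ 2 + 4 * d * y) / ((y + d) * (y + 2 * d)))⁻¹ = d * (y - 2 * d) / (y ^ 2 + 4 * d * y) := by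
      field_simp
      ring
    linarith [e]
  -- assemble: `y(1 − 𝓔⁺) ≥ y·(log x)/log 2 ≥ y·d(y−2d)/((y²+4dy) log 2) = d(y−2d)/((y+4d) log 2)`
  have h1 : 1 - rightExtensionZd d y ≥ Real.log ((y ^ 2 + 4 * d * y) / ((y + d) * (y + 2 * d))) / Real.log 2 := by
    rw [hlogx, ge_iff_le, div_le_iff₀ hlog2]
    have := mul_le_mul_of_nonneg_right hchord hlog2.le
    rw [div_mul_cancel₀ _ hlog2.ne'] at this
    nlinarith
  have h2 : d * (y - 2 * d) / ((y ^ 2 + 4 * d * y) * Real.log 2) ≤ 1 - rightExtensionZd d y := by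
    calc d * (y - 2 * d) / ((y ^ 2 + 4 * d * y) * Real.log 2) = d * (y - 2 * d) / (y ^ 2 + 4 * d * y) / Real.log 2 := by
          rw [div_div]
      _ ≤ Real.log ((y ^ 2 + 4 * d * y) / ((y + d) * (y + 2 * d))) / Real.log 2 := div_le_div_of_nonneg_right hkey hlog2.le
      _ ≤ 1 - rightExtensionZd d y := h1
  have e3 : d * (y - 2 * d) / ((y + 4 * d) * Real.log 2) = y * (d * (y - 2 * d) / ((y ^ 2 + 4 * d * y) * Real.log 2)) := by
    rw [mul_div_assoc', div_eq_div_iff (by positivity) (by positivity)]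
    ring
  rw [e3]
  exact mul_le_mul_of_nonneg_left h2 hy0.le

/-- **Upper side**: `y·(1 − 𝓔⁻_d(y)) ≤ 2d/log 2` for every `y ≥ 2` and every `d` (left chord of ratio `2`:
`1 − 𝓔⁻ ≤ log(1 + 2d/y)/log 2 ≤ 2d/(y log 2)`). [cite: JansevanRensburgWhittington2013, §3.2 Corollary 2 (arXiv v4 p. 11)] -/
theorem mul_one_sub_leftExtensionZd_le (d : ℕ) {y : ℝ} (hy : 2 ≤ y) :
    y * (1 - leftExtensionZd d y) ≤ 2 * d / Real.log 2 := by
  have hy0 : 0 < y := by linarith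
  have hd : (0 : ℝ) ≤ d := by positivity
  have hlog2 : 0 < Real.log 2 := Real.log_pos (by norm_num)
  have hchord := chord_half_le_leftExtensionZd d hy0
  have hup : pulledBridgeFreeEnergy (d + 1) (y / 2) ≤ Real.log (y / 2 + 2 * d) :=
    pulledBridgeFreeEnergy_le_log_add d (by linarith)
  have hlow := log_lower_envelope_le_pulledBridgeFreeEnergy d (show (1 : ℝ) ≤ y by linarith)
  -- `log 2 + log(y/2 + 2d) − log((y²+4dy)/(y+2d)) = log(1 + 2d/y) ≤ 2d/y`
  have hlogx : Real.log 2 + Real.log (y / 2 + 2 * d) - Real.log ((y ^ 2 + 4 * d * y) / (y + 2 * d)) = Real.log (1 + 2 * d / y) := by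
    have e : 1 + 2 * d / y = 2 * (y / 2 + 2 * d) / ((y ^ 2 + 4 * d * y) / (y + 2 * d)) := by
      field_simp
      ring
    rw [e, Real.log_div (show (2 * (y / 2 + 2 * d) : ℝ) ≠ 0 by positivity)
      (show ((y ^ 2 + 4 * d * y) / (y + 2 * d) : ℝ) ≠ 0 by positivity),
      Real.log_mul (show (2 : ℝ) ≠ 0 by norm_num) (show (y / 2 + 2 * d : ℝ) ≠ 0 by positivity)]
  have hlog1 : Real.log (1 + 2 * d / y) ≤ 2 * d / y := by
    have := Real.log_le_sub_one_of_pos (show 0 < 1 + 2 * d / y by positivity)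
    linarith
  have h1 : (1 - leftExtensionZd d y) * Real.log 2 ≤ 2 * d / y := by
    have := mul_le_mul_of_nonneg_right hchord hlog2.le
    rw [div_mul_cancel₀ _ hlog2.ne'] at this
    nlinarith
  rw [le_div_iff₀ hlog2]
  have := mul_le_mul_of_nonneg_left h1 hy0.le
  rw [mul_div_cancel₀ _ hy0.ne'] at this
  nlinarith

/-- ★ **THE EXTENSION-DENSITY WINDOW, EVERY DIMENSION**: for every `d` and every `y ≥ 2`,
`d(y − 2d)/((y + 4d)·log 2) ≤ y·(1 − 𝓔⁺_d(y)) ≤ y·(1 − 𝓔⁻_d(y)) ≤ 2d/log 2` — at force `log y` the pulled bridge on `ℤ^{d+1}` is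
stretched except for a fraction of its steps between `≈ 1.44·d/y` and `≈ 2.89·d/y`, constants free of `d`.
[cite: JansevanRensburgWhittington2013, §3.2 Theorem 8 and Corollary 2 (arXiv v4 p. 11)] -/
theorem extensionZd_window (d : ℕ) {y : ℝ} (hy : 2 ≤ y) :
    d * (y - 2 * d) / ((y + 4 * d) * Real.log 2) ≤ y * (1 - rightExtensionZd d y) ∧
      y * (1 - rightExtensionZd d y) ≤ y * (1 - leftExtensionZd d y) ∧
        y * (1 - leftExtensionZd d y) ≤ 2 * d / Real.log 2 := by
  have hy0 : 0 < y := by linarith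
  refine ⟨div_le_mul_one_sub_rightExtensionZd d (by linarith), ?_, mul_one_sub_leftExtensionZd_le d hy⟩
  have := leftExtensionZd_le_rightExtensionZd d y
  nlinarith
-- TODO(sharp constant): y·(1 − 𝓔^±_d(y)) → 2d needs chords of vanishing length against the second-order envelopes (planar: `SAWPulledLargeForce`).

/-- **Ballisticity**: `𝓔⁻_d(y) > 0` (hence `𝓔⁺_d(y) > 0`) for every `y ≥ 2` with `y > 2d/log 2`, every `d`.
[cite: JansevanRensburgWhittington2013, §3.2 Theorem 8 (arXiv v4 p. 11)] -/
theorem leftExtensionZd_pos (d : ℕ) {y : ℝ} (hy : 2 ≤ y) (hyd : 2 * d / Real.log 2 < y) : 0 < leftExtensionZd d y := by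
  have hy0 : 0 < y := by linarith
  have h := mul_one_sub_leftExtensionZd_le d hy
  by_contra hneg
  push Not at hneg
  have : y ≤ y * (1 - leftExtensionZd d y) := by nlinarith
  linarith

end Literature.Probability.RandomPlanarGeometry.SAW.Zd
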